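/-
Copyright: b2b-lace packet (certified numerics seat 3 / enumeration lane, gen 9).  LINK THEOREMS: the `d = 11`
trail table `bawRows` that the typed Stage 1 (`Stage1Cells`, model `MeanFieldD11Stage1Eval`) reads through
`tab (.baw j v)` agrees, entry by entry on the read keys, with the kernel-certified counts `#trailWordsTo 11 j x`
of `TrailCountTables*`.  Nothing of the record is touched; no fact; no `sorry`.
-/
import Literature.Probability.FitznerVanDerHofstad2017.TrailCountTables
import Literature.Probability.FitznerVanDerHofstad2017.TrailCountTablesN9a
import Literature.Probability.FitznerVanDerHofstad2017.TrailCountTablesN10c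
import Literature.Probability.FitznerVanDerHofstad2017.TrailCountTablesN11c
import Literature.Probability.FitznerVanDerHofstad2017.TrailCountTablesN12b
import Literature.Probability.FitznerVanDerHofstad2017.MeanFieldD11Stage1Eval
import HarnessLib

/-!
# The `d = 11` trail table of the typed Stage 1 equals the kernel-certified counts

The Stage-1 cells of Fitzner–van der Hofstad's `Percolation.nb` (typed in `Stage1Cells`) read the table
`nrBAW[j,d,v]` of bond-avoiding walks (trails) only at `v = {0}` (cell 11: `bubble`, `triangle`, `square`, with
`2 ≤ m ≤ j ≤ Explicit = 12`) and at `v = {1}`, `v = {2} ≙ e₁ + e₂` (cell 12: `openBubble`, `openTriangle`,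
`openSquare`, with `1 ≤ m ≤ j ≤ CS = 12`).  The audited `d = 11` model supplies these as the integer rows
`Stage1Cells.CertD11.bawRows` (an enumeration outside Lean).  This file proves, for every such key except the single
entry `(j, v) = (12, {2})` (whose trail tree, `7.4·10¹⁰` walks, is beyond this generation's kernel budget), that the row
entry IS the number of trails: `bawRows v j = #trailWordsTo 11 j x_v`, by the kernel theorems `card_trailWordsTo_n<j>_x…_d11`
of `TrailCountTables*` and the parity / reach vanishing rules.  In particular the `j = 11, 12` entries, which lie beyond
the range `n ≤ 10` tabulated in the notebook `SRW.nb` §3, are now kernel-certified.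

References: R. Fitzner, R. van der Hofstad, *Mean-field behavior for nearest-neighbor percolation in `d > 10`*,
Electron. J. Probab. 22 (2017) [FvdH17], notebooks `SRW.nb` §3 (`nrBAW`) and `Percolation.nb` cells 11–12;
*Generalized approach to the non-backtracking lace expansion*, PTRF 169 (2017) §5.3.1 pp. 1096–1097.
-/

namespace Literature.Probability.FitznerVanDerHofstad2017

open Stage1Cells Stage1Cells.CertD11

/-- parity vanishing at `x = 0`, `d = 11`. [folklore] -/
theorem card_trailWordsTo_d11_x0_odd (n : ℕ) (h : n % 2 = 1) :
    (trailWordsTo 11 n (siteOfList [] 11)).card = 0 :=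
  card_trailWordsTo_eq_zero_of_odd n _ (by rw [l1Norm_siteOfList (by decide)]; simpa using h)

/-- parity vanishing at `x = e₁`, `d = 11`. [folklore] -/
theorem card_trailWordsTo_d11_x1_even (n : ℕ) (h : n % 2 = 0) :
    (trailWordsTo 11 n (siteOfList [1] 11)).card = 0 :=
  card_trailWordsTo_eq_zero_of_odd n _ (by rw [l1Norm_siteOfList (by decide)]; simp; omega)

/-- reach vanishing at `x = e₁`, `d = 11`, `n = 0`. [folklore] -/
theorem card_trailWordsTo_d11_x1_zero : (trailWordsTo 11 0 (siteOfList [1] 11)).card = 0 :=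
  card_trailWordsTo_eq_zero_of_lt 0 _ (by rw [l1Norm_siteOfList (by decide)]; decide)

/-- parity vanishing at `x = e₁ + e₂`, `d = 11`. [folklore] -/
theorem card_trailWordsTo_d11_x11_odd (n : ℕ) (h : n % 2 = 1) :
    (trailWordsTo 11 n (siteOfList [1, 1] 11)).card = 0 :=
  card_trailWordsTo_eq_zero_of_odd n _ (by rw [l1Norm_siteOfList (by decide)]; simp; omega)

/-- reach vanishing at `x = e₁ + e₂`, `d = 11`, `n < 2`. [folklore] -/
theorem card_trailWordsTo_d11_x11_lt (n : ℕ) (h : n < 2) :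
    (trailWordsTo 11 n (siteOfList [1, 1] 11)).card = 0 :=
  card_trailWordsTo_eq_zero_of_lt n _ (by rw [l1Norm_siteOfList (by decide)]; simpa using h)

/-- Cell 11 keys: `nrBAW[j,11,{0}] = bawRows .v0 j` is the number of `j`-step trails `0 → 0` on `ℤ¹¹`, for every
`1 ≤ j ≤ 12 = Explicit` (the read range is `2 ≤ m ≤ j ≤ 12`; the unread entry `j = 0` of the row is `0`, the count is `1`).
[cite: FitznerVanDerHofstad2017, notebook SRW.nb §3 (nrBAW) and Percolation.nb cell 11] -/
theorem bawRows_v0_eq_card (j : ℕ) (hj₁ : 1 ≤ j) (hj : j ≤ 12) :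
    (bawRows .v0).getD j 0 = ((trailWordsTo 11 j (siteOfList [] 11)).card : ℚ) := by
  interval_cases j
  · rw [card_trailWordsTo_d11_x0_odd 1 (by decide)]; decide
  · rw [card_trailWordsTo_n2_x0_d11]; decide
  · rw [card_trailWordsTo_d11_x0_odd 3 (by decide)]; decide
  · rw [card_trailWordsTo_n4_x0_d11]; decide
  · rw [card_trailWordsTo_d11_x0_odd 5 (by decide)]; decide
  · rw [card_trailWordsTo_n6_x0_d11]; decide
  · rw [card_trailWordsTo_d11_x0_odd 7 (by decide)]; decide
  · rw [card_trailWordsTo_n8_x0_d11]; decide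
  · rw [card_trailWordsTo_d11_x0_odd 9 (by decide)]; decide
  · rw [card_trailWordsTo_n10_x0_d11]; decide
  · rw [card_trailWordsTo_d11_x0_odd 11 (by decide)]; decide
  · rw [card_trailWordsTo_n12_x0_d11]; decide

/-- Cell 12 keys: `nrBAW[j,11,{1}] = bawRows .v1 j` is the number of `j`-step trails `0 → e₁` on `ℤ¹¹`, for every
`j ≤ 12 = CS`. [cite: FitznerVanDerHofstad2017, notebook SRW.nb §3 (nrBAW) and Percolation.nb cell 12] -/
theorem bawRows_v1_eq_card (j : ℕ) (hj : j ≤ 12) :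
    (bawRows .v1).getD j 0 = ((trailWordsTo 11 j (siteOfList [1] 11)).card : ℚ) := by
  interval_cases j
  · rw [card_trailWordsTo_d11_x1_zero]; decide
  · rw [card_trailWordsTo_n1_x1_d11]; decide
  · rw [card_trailWordsTo_d11_x1_even 2 (by decide)]; decide
  · rw [card_trailWordsTo_n3_x1_d11]; decide
  · rw [card_trailWordsTo_d11_x1_even 4 (by decide)]; decide
  · rw [card_trailWordsTo_n5_x1_d11]; decide
  · rw [card_trailWordsTo_d11_x1_even 6 (by decide)]; decide
  · rw [card_trailWordsTo_n7_x1_d11]; decide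
  · rw [card_trailWordsTo_d11_x1_even 8 (by decide)]; decide
  · rw [card_trailWordsTo_n9_x1_d11]; decide
  · rw [card_trailWordsTo_d11_x1_even 10 (by decide)]; decide
  · rw [card_trailWordsTo_n11_x1_d11]; decide
  · rw [card_trailWordsTo_d11_x1_even 12 (by decide)]; decide

/-- Cell 12 keys: `nrBAW[j,11,{2}] = bawRows .v2 j` (`{2}` ≙ `e₁ + e₂` in the notebook's class numbering) is the number
of `j`-step trails `0 → e₁ + e₂` on `ℤ¹¹`, for every `j ≤ 11`; the read key `j = 12 = CS` (`73897908856`) is not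
kernel-certified here. [cite: FitznerVanDerHofstad2017, notebook SRW.nb §3 (nrBAW) and Percolation.nb cell 12] -/
theorem bawRows_v2_eq_card (j : ℕ) (hj : j ≤ 11) :
    (bawRows .v2).getD j 0 = ((trailWordsTo 11 j (siteOfList [1, 1] 11)).card : ℚ) := by
  interval_cases j
  · rw [card_trailWordsTo_d11_x11_lt 0 (by decide)]; decide
  · rw [card_trailWordsTo_d11_x11_lt 1 (by decide)]; decide
  · rw [card_trailWordsTo_n2_x11_d11]; decide
  · rw [card_trailWordsTo_d11_x11_odd 3 (by decide)]; decide
  · rw [card_trailWordsTo_n4_x11_d11]; decide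
  · rw [card_trailWordsTo_d11_x11_odd 5 (by decide)]; decide
  · rw [card_trailWordsTo_n6_x11_d11]; decide
  · rw [card_trailWordsTo_d11_x11_odd 7 (by decide)]; decide
  · rw [card_trailWordsTo_n8_x11_d11]; decide
  · rw [card_trailWordsTo_d11_x11_odd 9 (by decide)]; decide
  · rw [card_trailWordsTo_n10_x11_d11]; decide
  · rw [card_trailWordsTo_d11_x11_odd 11 (by decide)]; decide

end Literature.Probability.FitznerVanDerHofstad2017
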